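import Summits.QuantumFields.BalabanUV.InfraRed.StrongCouplingForestDoorAssembly
import Literature.Probability.LatticeModels.GibbsSpecificationTiltedHetero

/-!
# Strong coupling, forest gauge — the frozen specification (rung F3, part 1 of 3)

**observatory of the non-perturbative crossover; no mass-gap claim.**  Cell `pub-balaban`, build IR-3 v2
(two-front crossover ledger), IR-SC lineage.  Part 1 of the proof of rung F3 `FrozenForestClustering` of
`StrongCouplingForestDoorAssembly` (part 2 `StrongCouplingFrozenForestKR`, part 3 `StrongCouplingFrozenForestClustering`
with the theorem itself); companion of `StrongCouplingForestGaugeFixing` (the frozen a priori measure `frozenHaar F` and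
the frozen Wilson measure `frozenWilsonMeasure ρ F β`).

THE MECHANISM.  The frozen Wilson measure `μ_β^F = Z_F⁻¹ e^{−β S_W} d(⊗_{e ∉ F} Haar ⊗ ⊗_{e ∈ F} δ₁)` is a GIBBS MEASURE
of an explicit finite-range specification on the FULL link set of the torus, namely the Gibbsian specification with
SITE-DEPENDENT a priori measures `ν_e = δ₁` (`e ∈ F`), `ν_e = Haar` (`e ∉ F`) and the volume-independent bounded energy
`U ↦ ∑_q log v((freeze_F U)_q)` of the configuration FROZEN on `F` (the tree's
`isSpecification_tilted_map_glueWith_pi_hetero`; Friedli–Velenik §6.10.1, Georgii Def. 2.9).  This module: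
* §1 `freezeConfig F U` (set the links of `F` to `1`), its interaction with `glueWith`, measurability;
* §2 `frozenRef`, `frozenSpec`, `isSpecification_frozenSpec`, `frozenSpec_univ`; freezing is the identity
  `frozenHaar F`-a.e. (`freezeConfig_ae_eq`), so the energy may be frozen inside the tilt (`frozenHaar_tilted_freeze`);
* §3 the one-link laws: `δ₁` at a frozen link whatever the boundary condition (`siteLaw_frozenSpec_of_mem`), the torus
  one-link law at the FROZEN boundary condition at a dynamic link (`siteLaw_frozenSpec_of_not_mem`).

Every statement is kernel-checked; nothing here moves any number of the ledger (owned number unchanged, `β_W < 2/9`);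
no statement of the manuscripts under audit is used.  References (specification framework only):
[cite: Georgii2011, Def. 2.9] [cite: FriedliVelenik2017, §6.10.1 eq. (6.110) with Lemma 6.15].
-/

noncomputable section

open MeasureTheory ProbabilityTheory Filter Function Finset
open Literature.Probability.LatticeModels
open Literature.Probability.LatticeModels.DobrushinMetric
open Literature.MathematicalPhysics.QuantumFieldTheory
open Literature.MathematicalPhysics.QuantumLattice (groupHeatKernelWeight fundamentalRep fundamentalRep_apply fundamentalLatticeRep
  toTorusObservable LGConfig IsLocalObservable torusEdge torusLift)
open Literature.MathematicalPhysics.QuantumFieldTheory.Balaban1983to89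
open Literature.MathematicalPhysics.QuantumFieldTheory.Balaban1983to89.StrongCouplingDobrushinWindow
open Literature.MathematicalPhysics.QuantumFieldTheory.Balaban1983to89.StrongCouplingTorusWindow
open Summit.QuantumFields.BalabanUV.InfraRed.StrongCouplingForestGauge
open Summit.QuantumFields.BalabanUV.InfraRed.StrongCouplingForestGaugeFixing

namespace Summit.QuantumFields.BalabanUV.InfraRed.StrongCouplingFrozenForestSpec

/-! ### §1 Freezing a configuration on the forest -/

section Freeze

variable {d L : ℕ} {G : Type*} [Group G]

/-- The configuration **frozen on `F`**: `(freeze_F U)_e = 1` for `e ∈ F` and `U_e` otherwise.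
[cite: Creutz2022, Ch. 9, eq. (9.19), p. 44] -/
def freezeConfig (F : Finset (Edge d L)) (U : GaugeConfig d L G) : GaugeConfig d L G :=
  fun e => if e ∈ F then 1 else U e

variable (F : Finset (Edge d L))

/-- A frozen link carries `1`. [folklore] -/
theorem freezeConfig_of_mem {e : Edge d L} (he : e ∈ F) (U : GaugeConfig d L G) :
    freezeConfig F U e = 1 := by
  simp [freezeConfig, he]

/-- A dynamic link keeps its value. [folklore] -/
theorem freezeConfig_of_not_mem {e : Edge d L} (he : e ∉ F) (U : GaugeConfig d L G) :
    freezeConfig F U e = U e := by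
  simp [freezeConfig, he]

/-- Two configurations agreeing on the dynamic links have the same frozen configuration. [folklore] -/
theorem freezeConfig_congr {U V : GaugeConfig d L G} (h : ∀ e, e ∉ F → U e = V e) :
    freezeConfig F U = freezeConfig F V := by
  funext e
  by_cases he : e ∈ F
  · rw [freezeConfig_of_mem F he, freezeConfig_of_mem F he]
  · rw [freezeConfig_of_not_mem F he, freezeConfig_of_not_mem F he, h e he]

/-- Freezing commutes with gluing one dynamic link. [folklore] -/
theorem freezeConfig_glueWith_of_not_mem {e : Edge d L} (he : e ∉ F)
    (ζ : ↥({e} : Finset (Edge d L)) → G) (η : GaugeConfig d L G) :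
    freezeConfig F (glueWith {e} ζ η) = glueWith {e} ζ (freezeConfig F η) := by
  funext z
  by_cases hz : z = e
  · subst hz
    rw [freezeConfig_of_not_mem F he, glueWith_apply_mem _ _ _ (Finset.mem_singleton_self z),
      glueWith_apply_mem _ _ _ (Finset.mem_singleton_self z)]
  · have hz' : z ∉ ({e} : Finset (Edge d L)) := by simpa using hz
    by_cases hzF : z ∈ F
    · rw [freezeConfig_of_mem F hzF, glueWith_apply_not_mem _ _ _ hz', freezeConfig_of_mem F hzF]
    · rw [freezeConfig_of_not_mem F hzF, glueWith_apply_not_mem _ _ _ hz', glueWith_apply_not_mem _ _ _ hz',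
        freezeConfig_of_not_mem F hzF]

/-- Gluing a frozen link is invisible after freezing. [folklore] -/
theorem freezeConfig_glueWith_of_mem {e : Edge d L} (he : e ∈ F)
    (ζ : ↥({e} : Finset (Edge d L)) → G) (η : GaugeConfig d L G) :
    freezeConfig F (glueWith {e} ζ η) = freezeConfig F η := by
  refine freezeConfig_congr F fun z hz => ?_
  have hze : z ∉ ({e} : Finset (Edge d L)) := by
    rw [Finset.mem_singleton]
    rintro rfl
    exact hz he
  rw [glueWith_apply_not_mem _ _ _ hze]

variable [MeasurableSpace G]

/-- Freezing is measurable. [folklore] -/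
@[fun_prop]
theorem measurable_freezeConfig : Measurable (freezeConfig (G := G) F) := by
  refine measurable_pi_lambda _ fun e => ?_
  by_cases he : e ∈ F
  · simp only [freezeConfig, he, if_true]
    exact measurable_const
  · simp only [freezeConfig, he, if_false]
    exact measurable_pi_apply e

end Freeze

/-! ### §2 The frozen a priori measures and the frozen specification -/

section Spec

variable {d L : ℕ} [NeZero L] {G : Type*} [Group G] [TopologicalSpace G] [IsTopologicalGroup G]
  [CompactSpace G] [MeasurableSpace G] [BorelSpace G]

variable (F : Finset (Edge d L))

/-- The **frozen a priori measure** at a link: `δ₁` on the forest, Haar off it. [cite: Georgii2011, Def. 2.9] -/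
def frozenRef (e : Edge d L) : Measure G :=
  if e ∈ F then Measure.dirac 1 else haarProbability G

/-- Each frozen a priori measure is a probability measure. [folklore] -/
instance isProbabilityMeasure_frozenRef (e : Edge d L) : IsProbabilityMeasure (frozenRef (G := G) F e) := by
  unfold frozenRef
  split_ifs <;> infer_instance

/-- The frozen Haar measure of `StrongCouplingForestGaugeFixing` is the product of the frozen a priori measures.
[folklore] -/
theorem frozenHaar_eq_pi : frozenHaar (G := G) F = Measure.pi (frozenRef (G := G) F) := rfl

/-- The frozen Haar measure is a probability measure. [folklore] -/
instance isProbabilityMeasure_frozenHaar : IsProbabilityMeasure (frozenHaar (G := G) F) := by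
  rw [frozenHaar_eq_pi]
  infer_instance

/-- The **frozen specification** of the single-plaquette weight `v` and the frozen link set `F`: product of the
frozen a priori measures on `Λ`, glued with the boundary condition off `Λ`, tilted by the torus energy of the
configuration frozen on `F` (a Gibbsian specification with site-dependent reference measures).
[cite: Georgii2011, Def. 2.9] [cite: FriedliVelenik2017, §6.10.1 eq. (6.110) with Lemma 6.15] -/
def frozenSpec (v : G → ℝ) : Specification (Edge d L) G :=
  fun Λ η => ((Measure.pi fun e : ↥Λ => frozenRef (G := G) F (e : Edge d L)).map (glueWith Λ · η)).tilted
    (torusLogWeight v ∘ freezeConfig F)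

variable [SecondCountableTopology G]

/-- **The frozen specification is a specification** (probability kernels, outside measurability, properness,
consistency): the tree's hetero-reference Gibbsian-specification theorem with the volume-independent bounded
energy `∑_q log v((freeze_F U)_q)`. [cite: FriedliVelenik2017, §6.10.1 eq. (6.110) with Lemma 6.15] -/
theorem isSpecification_frozenSpec [MeasurableSingletonClass G] {v : G → ℝ} (hv : Continuous v)
    (hv0 : ∀ g, 0 < v g) : IsSpecification (frozenSpec (d := d) (L := L) (G := G) F v) := by
  obtain ⟨B, hB⟩ := exists_abs_torusLogWeight_le (d := d) (L := L) hv hv0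
  exact isSpecification_tilted_map_glueWith_pi_hetero (V := Edge d L) (S := G) (frozenRef (G := G) F)
    (fun e => IsProbabilityMeasure.ne_zero _) (φ := fun _ => torusLogWeight v ∘ freezeConfig F)
    (fun _ => (measurable_torusLogWeight hv).comp (measurable_freezeConfig F))
    (fun _ => ⟨B, fun σ => hB _⟩) (fun _ _ _ σ σ' _ => by simp)

omit [SecondCountableTopology G] in
/-- **In the full volume the frozen kernel is the frozen Haar measure tilted by the frozen energy**, whatever the
boundary condition. [cite: Georgii2011, Def. 2.9] -/
theorem frozenSpec_univ (v : G → ℝ) (η : GaugeConfig d L G) :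
    frozenSpec F v Finset.univ η = (frozenHaar (G := G) F).tilted (torusLogWeight v ∘ freezeConfig F) := by
  unfold frozenSpec
  rw [map_glueWith_univ_pi_hetero (frozenRef (G := G) F) η, frozenHaar_eq_pi]

omit [SecondCountableTopology G] in
/-- **Freezing is the identity `frozenHaar F`-almost everywhere**: each forest link carries the point mass at `1`.
[folklore] -/
theorem freezeConfig_ae_eq [MeasurableSingletonClass G] :
    ∀ᵐ U ∂(frozenHaar (G := G) F), freezeConfig F U = U := by
  have hset : MeasurableSet {g : G | g = 1} := by
    rw [Set.setOf_eq_eq_singleton]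
    exact measurableSet_singleton 1
  have h : ∀ e ∈ F, ∀ᵐ U ∂(frozenHaar (G := G) F), U e = 1 := by
    intro e he
    have h1 : ∀ᵐ g ∂((frozenHaar (G := G) F).map fun U => U e), g = 1 := by
      rw [frozenHaar_eq_pi, (measurePreserving_eval (frozenRef (G := G) F) e).map_eq]
      unfold frozenRef
      rw [if_pos he]
      exact (ae_dirac_iff hset).2 rfl
    exact (ae_map_iff (measurable_pi_apply e).aemeasurable hset).1 h1
  filter_upwards [(Filter.eventually_all_finset F).2 h] with U hU
  funext e
  by_cases he : e ∈ F
  · rw [freezeConfig_of_mem F he, hU e he]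
  · rw [freezeConfig_of_not_mem F he]

omit [SecondCountableTopology G] in
/-- Tilting the frozen Haar measure by an energy or by its frozen version gives the same measure. [folklore] -/
theorem frozenHaar_tilted_freeze [MeasurableSingletonClass G] (H : GaugeConfig d L G → ℝ) :
    (frozenHaar (G := G) F).tilted (H ∘ freezeConfig F) = (frozenHaar (G := G) F).tilted H :=
  tilted_congr ((freezeConfig_ae_eq (G := G) F).mono fun U hU => by
    simp only [Function.comp_apply, hU])

/-! ### §3 The one-link laws of the frozen specification -/

/-- **At a frozen link the conditional law is `δ₁`**, whatever the boundary condition. [folklore] -/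
theorem siteLaw_frozenSpec_of_mem {v : G → ℝ} (hv : Continuous v) {e : Edge d L} (he : e ∈ F)
    (ω : GaugeConfig d L G) : siteLaw (frozenSpec F v) e ω = Measure.dirac 1 := by
  have hHf : Measurable (torusLogWeight (d := d) (L := L) v ∘ freezeConfig F) :=
    (measurable_torusLogWeight hv).comp (measurable_freezeConfig F)
  have hfam : (fun x : ↥({e} : Finset (Edge d L)) => frozenRef (G := G) F (x : Edge d L)) =
      fun _ => Measure.dirac (1 : G) := by
    funext x
    unfold frozenRef
    rw [if_pos]
    rw [Finset.mem_singleton.1 x.2]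
    exact he
  set ν : Measure (↥({e} : Finset (Edge d L)) → G) := Measure.pi fun _ => Measure.dirac (1 : G) with hν
  have hconst : ((torusLogWeight v ∘ freezeConfig F) ∘ fun ζ : ↥({e} : Finset (Edge d L)) → G =>
      glueWith {e} ζ ω) = fun _ => torusLogWeight v (freezeConfig F ω) := by
    funext ζ
    simp only [Function.comp_apply, freezeConfig_glueWith_of_mem F he]
  have h2 : ((fun σ : GaugeConfig d L G => σ e) ∘ fun ζ : ↥({e} : Finset (Edge d L)) → G =>
      glueWith {e} ζ ω) = fun ζ => ζ ⟨e, Finset.mem_singleton_self e⟩ := by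
    funext ζ
    simp only [Function.comp_apply, glueWith_apply_mem _ _ _ (Finset.mem_singleton_self e)]
  unfold siteLaw frozenSpec
  rw [hfam, ← map_tilted_comp ν (measurable_glueWith _ ω) hHf, hconst, tilted_const,
    Measure.map_map (measurable_pi_apply e) (measurable_glueWith _ ω), h2]
  exact (measurePreserving_eval (fun _ : ↥({e} : Finset (Edge d L)) => Measure.dirac (1 : G))
    ⟨e, Finset.mem_singleton_self e⟩).map_eq

/-- **At a dynamic link the conditional law is the torus one-link law at the FROZEN boundary condition**:
`γ^F_e(· | ω) = γ_e(· | freeze_F ω)` as laws of `U_e`. [folklore] -/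
theorem siteLaw_frozenSpec_of_not_mem {v : G → ℝ} (hv : Continuous v) {e : Edge d L} (he : e ∉ F)
    (ω : GaugeConfig d L G) :
    siteLaw (frozenSpec F v) e ω = siteLaw (torusWeightSpec v) e (freezeConfig F ω) := by
  have hH : Measurable (torusLogWeight (d := d) (L := L) v) := measurable_torusLogWeight hv
  have hHf : Measurable (torusLogWeight (d := d) (L := L) v ∘ freezeConfig F) :=
    hH.comp (measurable_freezeConfig F)
  have hfam : (fun x : ↥({e} : Finset (Edge d L)) => frozenRef (G := G) F (x : Edge d L)) =
      fun _ => haarProbability G := by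
    funext x
    unfold frozenRef
    rw [if_neg]
    rw [Finset.mem_singleton.1 x.2]
    exact he
  set ν : Measure (↥({e} : Finset (Edge d L)) → G) := Measure.pi fun _ => haarProbability G with hν
  have h1 : ((torusLogWeight v ∘ freezeConfig F) ∘ fun ζ : ↥({e} : Finset (Edge d L)) → G =>
      glueWith {e} ζ ω) = torusLogWeight v ∘ fun ζ => glueWith {e} ζ (freezeConfig F ω) := by
    funext ζ
    simp only [Function.comp_apply, freezeConfig_glueWith_of_not_mem F he]
  have h2 : ((fun σ : GaugeConfig d L G => σ e) ∘ fun ζ : ↥({e} : Finset (Edge d L)) → G =>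
      glueWith {e} ζ ω) = (fun σ : GaugeConfig d L G => σ e) ∘ fun ζ => glueWith {e} ζ (freezeConfig F ω) := by
    funext ζ
    simp only [Function.comp_apply, glueWith_apply_mem _ _ _ (Finset.mem_singleton_self e)]
  unfold siteLaw frozenSpec torusWeightSpec
  rw [hfam, ← map_tilted_comp ν (measurable_glueWith _ ω) hHf,
    ← map_tilted_comp ν (measurable_glueWith _ (freezeConfig F ω)) hH,
    Measure.map_map (measurable_pi_apply e) (measurable_glueWith _ ω),
    Measure.map_map (measurable_pi_apply e) (measurable_glueWith _ (freezeConfig F ω)), h1, h2]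

end Spec

end Summit.QuantumFields.BalabanUV.InfraRed.StrongCouplingFrozenForestSpec
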